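import Mathlib.Algebra.DirectSum.Decomposition
import Literature.AlgebraicGeometry.Motives.LefschetzLambdaProofs
import Literature.AlgebraicGeometry.Motives.LefschetzDecompositionProofs
import Literature.AlgebraicGeometry.Motives.WeilCohomologyProofs
import Literature.AlgebraicGeometry.Motives.CorrespondencesKunneth
import HarnessLib

/-!
# The `𝔰𝔩₂`-triple of a polarised variety for an abstract Weil cohomology theory

For a Weil cohomology theory `W : WeilCohomology k K` with the hard Lefschetz property, `X` smooth
projective of dimension `n` and `η` a hyperplane class, this file constructs Kleiman's operator
`ᶜΛ` (S. Kleiman, *Algebraic cycles and the Weil conjectures* (1968), 1.4.6: the triple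
`(ᶜΛ, L, H)` is an `𝔰𝔩₂`-triple; J. J. Ramón Marí, *On the Lefschetz standard conjecture* (2008),
Prop. 1.1 and Lemma 2.4) and proves, formally in the axioms of
`Literature.AlgebraicGeometry.Motives.WeilCohomology`:

* `clambdaOp_apply_lefschetzPow_succ`: on the Lefschetz decomposition `Hᵃ(X) = ⨁ Lᵗ Pⁱ(X)`,
  `ᶜΛ (Lᵗ⁺¹ x) = (t + 1)(n - i - t) Lᵗ x` for `x ∈ Pⁱ(X)` primitive (and `ᶜΛ x = 0`);
* `lefschetz_clambda_sub_clambda_lefschetz`: the `𝔰𝔩₂` relation `[L, ᶜΛ] = (a - n) · id` on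
  `Hᵃ(X)` (Kleiman 1968, 1.4.6, with `H = ∑ (n - a) πᵃ`);
* `cupPairing_clambdaOp_left`: `ᶜΛ` is symmetric for the Poincaré duality pairing,
  `tr (ᶜΛ x ∪ z) = tr (x ∪ ᶜΛ z)` (Ramón Marí 2008, Lemma 2.4; Kleiman 1968 §1.4).

The operator is *constructed* as `ᶜΛ = Λ ∘ N`, where `Λ` is Kleiman's normalised operator
(`Λ (Lᵗ⁺¹ x) = Lᵗ x`, `WeilCohomology.exists_isLambdaOp`) and `N` is the "weight" operator acting on
the summand `Lᵗ Pⁱ(X)` of the Lefschetz decomposition (`lefschetz_decomposition_holds`, turned into a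
`DirectSum.Decomposition`) by the scalar `t (n - i - t + 1)`. These are the tools for the proof of
`D(X × X) ⇒ B(X)` (Kleiman 1968, Thm. 2.9 with §3), where the `𝔰𝔩₂`-triple of `X × X` is the
tensor product of that of `X` with itself. Everything here is a theorem or an explicit definition;
no named fact is introduced and nothing of `Lefschetz.lean` / `StandardConjectures.lean` is restated.

## References

* S. Kleiman, *Algebraic cycles and the Weil conjectures*, in: Dix exposés sur la cohomologie des
  schémas, North-Holland (1968), 359–386, §1.4 (1.4.1, 1.4.2, 1.4.4, 1.4.6).
  [Kleiman1968AlgebraicCycles]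
* J. J. Ramón Marí, *On the Lefschetz standard conjecture*, arXiv:math/0703005 (2007/2008),
  Prop. 1.1, Lemmas 2.3–2.4 (held: `paper:arxiv-math_0703005`, chunks p0002, p0004).
-/

universe u v

open CategoryTheory AlgebraicGeometry
open scoped DirectSum

noncomputable section

namespace Literature.AlgebraicGeometry.Motives

namespace WeilCohomology

variable {k : Type u} [Field k] {K : Type v} [Field K] [CharZero K] (W : WeilCohomology k K)
variable {n : ℕ} {X : SchemeOver k} {η : W.obj X 2}

/-! ## The Lefschetz summands as a decomposition, and the weight operator -/

/-- The Lefschetz summand `Lᵗ Pᵃ(X) ⊆ Hⁱ(X)` indexed by `p = (a, t)` with `a + 2t = i`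
(`X` of dimension `n`, hyperplane class `η`; Kleiman 1968, 1.4.1). This is the family of
`WeilCohomology.lefschetz_decomposition`. [cite: Kleiman1968AlgebraicCycles, §1.4 (1.4.1)] -/
def lefschetzSummand (n : ℕ) (η : W.obj X 2) (i : ℕ) (p : {p : ℕ × ℕ // p.1 + 2 * p.2 = i}) :
    Submodule K (W.obj X i) :=
  (W.primitiveSubmodule X n η p.1.1).map (W.lefschetzPow X η p.1.2 p.1.1 i p.2)

/-- `Lᵗ x ∈ Lᵗ Pᵃ(X)` for `x` primitive. [folklore] -/
theorem lefschetzPow_mem_lefschetzSummand {a t i : ℕ} (h : a + 2 * t = i) {x : W.obj X a}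
    (hx : W.IsPrimitive n η x) :
    W.lefschetzPow X η t a i h x ∈ W.lefschetzSummand n η i ⟨(a, t), h⟩ :=
  Submodule.mem_map_of_mem (f := W.lefschetzPow X η t a i h)
    ((W.mem_primitiveSubmodule X n η x).mpr hx)

/-- The **Lefschetz decomposition as a `DirectSum.Decomposition`** of `Hⁱ(X)` (noncomputably
chosen from the internal direct sum `lefschetz_decomposition_holds`, Kleiman 1968, 1.4.1). [cite: Kleiman1968AlgebraicCycles, §1.4 (1.4.1)] -/
@[implicit_reducible]
def lefschetzDecomposition (hL : W.HasHardLefschetz) (hX : IsSmoothProjective n X)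
    (hη : W.IsHyperplaneClass X η) (i : ℕ) :
    DirectSum.Decomposition (W.lefschetzSummand n η i) :=
  (W.lefschetz_decomposition_holds hL hX hη i).chooseDecomposition

/-- The `𝔰𝔩₂` weight coefficient `t (n - a - t + 1)` of the summand `Lᵗ Pᵃ(X)` (an integer;
for `a + t ≤ n` it is the classical coefficient `t (m - t + 1)`, `m = n - a`, of the lowering
operator on the string through a lowest-weight vector of weight `-m`). [folklore] -/
def sl2Coeff (n : ℕ) (p : ℕ × ℕ) : ℤ := p.2 * ((n : ℤ) - p.1 - p.2 + 1)

/-- The **weight operator** `N` on `Hⁱ(X)`: it acts on the Lefschetz summand `Lᵗ Pᵃ(X)` by the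
scalar `t (n - a - t + 1)` (`sl2Coeff`). Auxiliary to `ᶜΛ = Λ ∘ N`. [folklore] -/
def weightOp (hL : W.HasHardLefschetz) (hX : IsSmoothProjective n X)
    (hη : W.IsHyperplaneClass X η) (i : ℕ) : W.obj X i →ₗ[K] W.obj X i :=
  letI := W.lefschetzDecomposition hL hX hη i
  (DirectSum.toModule K _ (W.obj X i) fun p ↦
      ((sl2Coeff n p.1 : ℤ) : K) • (W.lefschetzSummand n η i p).subtype) ∘ₗ
    (DirectSum.decomposeLinearEquiv (W.lefschetzSummand n η i)).toLinearMap

/-- The weight operator acts on the summand `p = (a, t)` by the scalar `t (n - a - t + 1)`. [folklore] -/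
theorem weightOp_apply_of_mem (hL : W.HasHardLefschetz) (hX : IsSmoothProjective n X)
    (hη : W.IsHyperplaneClass X η) {i : ℕ} (p : {p : ℕ × ℕ // p.1 + 2 * p.2 = i})
    {y : W.obj X i} (hy : y ∈ W.lefschetzSummand n η i p) :
    W.weightOp hL hX hη i y = ((sl2Coeff n p.1 : ℤ) : K) • y := by
  letI := W.lefschetzDecomposition hL hX hη i
  simp only [weightOp, LinearMap.coe_comp, LinearEquiv.coe_coe, Function.comp_apply]
  rw [show y = ((⟨y, hy⟩ : W.lefschetzSummand n η i p) : W.obj X i) from rfl,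
    DirectSum.decomposeLinearEquiv_apply_coe, DirectSum.toModule_lof]
  rfl

/-- `N (Lᵗ x) = t (n - a - t + 1) Lᵗ x` for `x ∈ Pᵃ(X)` primitive. [folklore] -/
theorem weightOp_apply_lefschetzPow (hL : W.HasHardLefschetz) (hX : IsSmoothProjective n X)
    (hη : W.IsHyperplaneClass X η) {a t i : ℕ} (h : a + 2 * t = i) {x : W.obj X a}
    (hx : W.IsPrimitive n η x) :
    W.weightOp hL hX hη i (W.lefschetzPow X η t a i h x) =
      ((t * ((n : ℤ) - a - t + 1) : ℤ) : K) • W.lefschetzPow X η t a i h x :=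
  W.weightOp_apply_of_mem hL hX hη ⟨(a, t), h⟩ (W.lefschetzPow_mem_lefschetzSummand h hx)

/-! ## The operator `ᶜΛ` -/

/-- Kleiman's normalised operator `Λ` of `(X, η)` under hard Lefschetz (a choice of the operator of
`WeilCohomology.exists_isLambdaOp`; it is unique, `isLambdaOp_unique`). [cite: Kleiman1968AlgebraicCycles, §1.4 (1.4.2)] -/
def lambdaOp (hL : W.HasHardLefschetz) (hX : IsSmoothProjective n X)
    (hη : W.IsHyperplaneClass X η) : W.GradedOp X X :=
  (W.exists_isLambdaOp hL hX hη).choose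

/-- `lambdaOp` is a `Λ`-operator in Kleiman's sense. [cite: Kleiman1968AlgebraicCycles, §1.4 (1.4.2)] -/
theorem isLambdaOp_lambdaOp (hL : W.HasHardLefschetz) (hX : IsSmoothProjective n X)
    (hη : W.IsHyperplaneClass X η) : W.IsLambdaOp n η (W.lambdaOp hL hX hη) :=
  (W.exists_isLambdaOp hL hX hη).choose_spec

/-- **Kleiman's operator `ᶜΛ`** of `(X, η)` (Kleiman 1968, 1.4.6; Ramón Marí 2008, §1:
`ᶜΛ x = ∑ⱼ j (n - i + j + 1) Lʲ⁻¹ x_{i-2j}` for `x = ∑ⱼ Lʲ x_{i-2j} ∈ Hⁱ(X)`), realised as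
`ᶜΛ = Λ ∘ N`: the graded operator of degree `-2` acting on the Lefschetz summands by
`ᶜΛ (Lᵗ x) = t (n - a - t + 1) Lᵗ⁻¹ x`, `x ∈ Pᵃ(X)`. It is the lowering operator of the
`𝔰𝔩₂`-triple `(L, ᶜΛ, deg - n)` (`lefschetz_clambda_sub_clambda_lefschetz`). [cite: Kleiman1968AlgebraicCycles, §1.4 (1.4.6)] -/
def clambdaOp (hL : W.HasHardLefschetz) (hX : IsSmoothProjective n X)
    (hη : W.IsHyperplaneClass X η) : W.GradedOp X X :=
  fun a b ↦ W.lambdaOp hL hX hη a b ∘ₗ W.weightOp hL hX hη a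

/-- The components of `ᶜΛ` off degree `-2` vanish. [folklore] -/
theorem clambdaOp_eq_zero_of_ne (hL : W.HasHardLefschetz) (hX : IsSmoothProjective n X)
    (hη : W.IsHyperplaneClass X η) {a b : ℕ} (hab : b + 2 ≠ a) : W.clambdaOp hL hX hη a b = 0 := by
  simp only [clambdaOp, (W.isLambdaOp_lambdaOp hL hX hη).1 a b hab, LinearMap.zero_comp]

/-- **`ᶜΛ` on the Lefschetz summands**: `ᶜΛ (Lᵗ⁺¹ x) = (t + 1)(n - a - t) Lᵗ x` for `x ∈ Pᵃ(X)`
primitive (Kleiman 1968, 1.4.6; when `a + t + 1 > n` both sides vanish). [cite: Kleiman1968AlgebraicCycles, §1.4 (1.4.6)] -/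
theorem clambdaOp_apply_lefschetzPow_succ (hL : W.HasHardLefschetz) (hX : IsSmoothProjective n X)
    (hη : W.IsHyperplaneClass X η) {a t i j : ℕ} (h₁ : a + 2 * (t + 1) = i) (h₂ : a + 2 * t = j)
    {x : W.obj X a} (hx : W.IsPrimitive n η x) :
    W.clambdaOp hL hX hη i j (W.lefschetzPow X η (t + 1) a i h₁ x) =
      (((t + 1) * ((n : ℤ) - a - t) : ℤ) : K) • W.lefschetzPow X η t a j h₂ x := by
  simp only [clambdaOp, LinearMap.coe_comp, Function.comp_apply]
  rw [W.weightOp_apply_lefschetzPow hL hX hη h₁ hx, LinearMap.map_smul]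
  have hc : (((t + 1 : ℕ) : ℤ) * ((n : ℤ) - a - (t + 1 : ℕ) + 1) : ℤ) =
      ((t + 1) * ((n : ℤ) - a - t) : ℤ) := by
    push_cast
    ring
  rw [hc]
  by_cases hle : a + (t + 1) ≤ n
  · rw [(W.isLambdaOp_lambdaOp hL hX hη).2.2 a x hx t i j h₁ h₂ hle]
  · rw [W.lefschetzPow_eq_zero_of_isPrimitive hX η hx h₁ (by omega), map_zero, smul_zero]
    by_cases heq : a + t = n
    · have h0 : ((t + 1) * ((n : ℤ) - a - t) : ℤ) = 0 := by
        have : ((n : ℤ) - a - t) = 0 := by omega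
        rw [this, mul_zero]
      rw [h0, Int.cast_zero, zero_smul]
    · rw [W.lefschetzPow_eq_zero_of_isPrimitive hX η hx h₂ (by omega), smul_zero]

/-- `ᶜΛ` kills primitive classes (the weight coefficient of `L⁰ Pᵃ` is `0`). [cite: Kleiman1968AlgebraicCycles, §1.4 (1.4.6)] -/
theorem clambdaOp_apply_of_isPrimitive (hL : W.HasHardLefschetz) (hX : IsSmoothProjective n X)
    (hη : W.IsHyperplaneClass X η) {a b : ℕ} {x : W.obj X a} (hx : W.IsPrimitive n η x) :
    W.clambdaOp hL hX hη a b x = 0 := by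
  simp only [clambdaOp, LinearMap.coe_comp, Function.comp_apply]
  have h0 : W.weightOp hL hX hη a x = 0 := by
    have h := W.weightOp_apply_lefschetzPow hL hX hη (t := 0) (a := a) (i := a) rfl hx
    rw [W.lefschetzPow_zero_apply hX η] at h
    rw [h]
    simp
  rw [h0, map_zero]

/-! ## The `𝔰𝔩₂` relation `[L, ᶜΛ] = deg - n` -/

/-- **The `𝔰𝔩₂` relation** (Kleiman 1968, 1.4.6: `[ᶜΛ, L] = H` with `H = ∑ₐ (n - a) πᵃ`; Ramón Marí
2008, Prop. 1.1): on `Hᵃ(X)` with `a ≥ 2` (`b + 2 = a`, `a + 2 = c`),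
`L (ᶜΛ y) - ᶜΛ (L y) = (a - n) y`. Checked on the spanning family `Lʲ x`, `x ∈ Pⁱ(X)` primitive
(`lefschetz_induction`), where it is the identity `(j)(m - j + 1) - (j + 1)(m - j) = 2j - m`,
`m = n - i`. [cite: Kleiman1968AlgebraicCycles, §1.4 (1.4.6)] -/
theorem lefschetz_clambda_sub_clambda_lefschetz (hL : W.HasHardLefschetz)
    (hX : IsSmoothProjective n X) (hη : W.IsHyperplaneClass X η) {b a c : ℕ}
    (hba : b + 2 * 1 = a) (hac : a + 2 * 1 = c) (y : W.obj X a) :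
    W.lefschetzPow X η 1 b a hba (W.clambdaOp hL hX hη a b y) -
        W.clambdaOp hL hX hη c a (W.lefschetzPow X η 1 a c hac y) =
      (((a : ℤ) - n : ℤ) : K) • y := by
  induction y using W.lefschetz_induction hL hX hη with
  | zero => simp
  | add y z hy hz => rw [map_add, map_add, map_add, map_add, smul_add, ← hy, ← hz]; abel
  | prim i j h x hx hij =>
    rcases j with _ | s
    · -- `y = L⁰ x = x` is primitive
      obtain rfl : a = i := by omega
      rw [W.lefschetzPow_zero_apply hX η h x, W.clambdaOp_apply_of_isPrimitive hL hX hη hx,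
        map_zero, zero_sub,
        W.clambdaOp_apply_lefschetzPow_succ hL hX hη (t := 0) hac (show a + 2 * 0 = a from rfl) hx,
        W.lefschetzPow_zero_apply hX η, ← neg_smul]
      congr 1
      push_cast
      ring
    · -- `y = Lˢ⁺¹ x`
      have hb' : i + 2 * s = b := by omega
      have hc' : i + 2 * (s + 1 + 1) = c := by omega
      rw [W.clambdaOp_apply_lefschetzPow_succ hL hX hη h hb' hx, LinearMap.map_smul,
        W.lefschetzPow_lefschetzPow hX η (r := s) (s := 1) (t := s + 1) rfl hb' hba h x,
        W.lefschetzPow_lefschetzPow hX η (r := s + 1) (s := 1) (t := s + 1 + 1) rfl h hac hc' x,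
        W.clambdaOp_apply_lefschetzPow_succ hL hX hη hc' h hx, ← sub_smul]
      subst h
      congr 1
      push_cast
      ring

/-- The `𝔰𝔩₂` relation in the lowest degrees `a ≤ 1`, where `ᶜΛ` vanishes on `Hᵃ(X)` (every class
being primitive): `ᶜΛ (L y) = (n - a) y` (Kleiman 1968, 1.4.6). [cite: Kleiman1968AlgebraicCycles, §1.4 (1.4.6)] -/
theorem clambda_lefschetz_of_le_one (hL : W.HasHardLefschetz) (hX : IsSmoothProjective n X)
    (hη : W.IsHyperplaneClass X η) {a c : ℕ} (ha : a ≤ 1) (hac : a + 2 * 1 = c) (y : W.obj X a) :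
    W.clambdaOp hL hX hη c a (W.lefschetzPow X η 1 a c hac y) = (((n : ℤ) - a : ℤ) : K) • y := by
  have hy : W.IsPrimitive n η y :=
    ⟨fun _ ↦ by
      haveI := W.subsingleton_obj hX (i := a) (by omega)
      exact Subsingleton.elim _ _,
     fun r j h hr ↦ by
      haveI := W.subsingleton_obj hX (i := j) (by omega)
      exact Subsingleton.elim _ _⟩
  rw [W.clambdaOp_apply_lefschetzPow_succ hL hX hη (t := 0) hac (show a + 2 * 0 = a from rfl) hy,
    W.lefschetzPow_zero_apply hX η]
  congr 1
  push_cast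
  ring

/-- Every class of degree `a ≤ 1` is killed by `ᶜΛ` (it is primitive). [folklore] -/
theorem clambdaOp_apply_of_le_one (hL : W.HasHardLefschetz) (hX : IsSmoothProjective n X)
    (hη : W.IsHyperplaneClass X η) {a b : ℕ} (ha : a ≤ 1) (y : W.obj X a) :
    W.clambdaOp hL hX hη a b y = 0 := by
  have hy : W.IsPrimitive n η y :=
    ⟨fun _ ↦ by
      haveI := W.subsingleton_obj hX (i := a) (by omega)
      exact Subsingleton.elim _ _,
     fun r j h hr ↦ by
      haveI := W.subsingleton_obj hX (i := j) (by omega)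
      exact Subsingleton.elim _ _⟩
  exact W.clambdaOp_apply_of_isPrimitive hL hX hη hy

/-! ## Symmetry of `L` and `ᶜΛ` for the Poincaré pairing -/

/-- `Lᵖ` is self-adjoint for the cup-product pairing, `⟨Lᵖ u, v⟩ = ⟨u, Lᵖ v⟩` (`cup_assoc`,
`cup_comm` with even degree). Private copy of `WeilCohomology.cupPairing_lefschetzPow_left`
(`StandardConjecturesProofs`), kept local so that this file does not depend on that module. [folklore] -/
private theorem lefschetzPow_adjoint_aux (hX : IsSmoothProjective n X) (η : W.obj X 2)
    {a i j m m' : ℕ} (h₁ : i + 2 * a = j) (h₂ : j + m = 2 * n) (h₃ : m + 2 * a = m')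
    (h₄ : i + m' = 2 * n) (u : W.obj X i) (v : W.obj X m) :
    W.cupPairing X n j m h₂ (W.lefschetzPow X η a i j h₁ u) v =
      W.cupPairing X n i m' h₄ u (W.lefschetzPow X η a m m' h₃ v) := by
  simp only [cupPairing_apply, PreWeilCohomology.lefschetzPow, LinearMap.flip_apply]
  rw [W.cup_assoc hX h₁ (show 2 * a + m = m' by omega) h₂ h₄ u (W.pow X η a) v,
    W.cup_comm_of_even hX (show 2 * a + m = m' by omega) h₃ (Or.inl ⟨a, two_mul a⟩)
      (W.pow X η a) v]

/-- `⟨Lᵖ x, L^q z⟩ = ⟨x, Lʳ z⟩` for `q + p = r`. [folklore] -/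
theorem cupPairing_lefschetzPow_lefschetzPow (hX : IsSmoothProjective n X) (η : W.obj X 2)
    {i i' p q r b d e : ℕ} (hr : q + p = r) (hb : i + 2 * p = b) (hd : i' + 2 * q = d)
    (he : i' + 2 * r = e) (h₁ : b + d = 2 * n) (h₂ : i + e = 2 * n) (x : W.obj X i)
    (z : W.obj X i') :
    W.cupPairing X n b d h₁ (W.lefschetzPow X η p i b hb x) (W.lefschetzPow X η q i' d hd z) =
      W.cupPairing X n i e h₂ x (W.lefschetzPow X η r i' e he z) := by
  rw [W.lefschetzPow_adjoint_aux hX η hb h₁ (show d + 2 * p = e by omega) h₂,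
    W.lefschetzPow_lefschetzPow hX η hr hd _ he]

/-- Orthogonality of Lefschetz summands, first half: `⟨x, L^S z⟩ = 0` for `z ∈ Pⁱ'(X)` primitive
and `x` of degree `i < i'` (then `i' + S > n`, so `L^S z = 0`; Ramón Marí 2008, Lemma 2.3, here
without linear sections). [folklore] -/
theorem cupPairing_lefschetzPow_eq_zero_of_lt (hX : IsSmoothProjective n X) (η : W.obj X 2)
    {i i' S d : ℕ} (hd : i' + 2 * S = d) (h : i + d = 2 * n) (hlt : i < i') (x : W.obj X i)
    {z : W.obj X i'} (hz : W.IsPrimitive n η z) :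
    W.cupPairing X n i d h x (W.lefschetzPow X η S i' d hd z) = 0 := by
  rw [W.lefschetzPow_eq_zero_of_isPrimitive hX η hz hd (by omega), map_zero]

/-- Orthogonality of Lefschetz summands, second half: `⟨x, L^S z⟩ = 0` for `x ∈ Pⁱ(X)` primitive
and `z` of degree `i' < i` (`⟨x, L^S z⟩ = ± ⟨z, L^S x⟩` and `L^S x = 0`). [folklore] -/
theorem cupPairing_lefschetzPow_eq_zero_of_gt (hX : IsSmoothProjective n X) (η : W.obj X 2)
    {i i' S d : ℕ} (hd : i' + 2 * S = d) (h : i + d = 2 * n) (hgt : i' < i) {x : W.obj X i}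
    (hx : W.IsPrimitive n η x) (z : W.obj X i') :
    W.cupPairing X n i d h x (W.lefschetzPow X η S i' d hd z) = 0 := by
  have hdi : d + i = 2 * n := by omega
  have key : W.cupPairing X n d i hdi (W.lefschetzPow X η S i' d hd z) x = 0 := by
    rw [W.lefschetzPow_adjoint_aux hX η hd hdi rfl (show i' + (i + 2 * S) = 2 * n by omega) z x,
      W.lefschetzPow_eq_zero_of_isPrimitive hX η hx rfl (by omega), map_zero]
  simp only [PreWeilCohomology.cupPairing, LinearMap.compr₂_apply] at key ⊢
  rw [W.cup_comm hX h hdi x, map_zsmul, key, smul_zero]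

/-- **`ᶜΛ` is symmetric for the Poincaré pairing**: `tr (ᶜΛ x ∪ z) = tr (x ∪ ᶜΛ z)` for
`x ∈ Hᵃ(X)`, `z ∈ Hᶜ(X)`, `a + c = 2n + 2` (Ramón Marí 2008, Lemma 2.4; Kleiman 1968 §1.4). On
the spanning classes `x = Lʲ x₀`, `z = Lʲ' z₀` (`x₀ ∈ Pⁱ`, `z₀ ∈ Pⁱ'`) both sides vanish unless
`i = i'` (orthogonality of the Lefschetz summands), and for `i = i'` they are
`j (m - j + 1) ⟨x₀, Lᵐ z₀⟩` and `j' (m - j' + 1) ⟨x₀, Lᵐ z₀⟩` with `j + j' = m + 1`, `m = n - i`. [cite: Kleiman1968AlgebraicCycles, §1.4 (1.4.6)] -/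
theorem cupPairing_clambdaOp_left (hL : W.HasHardLefschetz) (hX : IsSmoothProjective n X)
    (hη : W.IsHyperplaneClass X η) {a b c d : ℕ} (hb : b + 2 = a) (hd : d + 2 = c)
    (h₁ : b + c = 2 * n) (h₂ : a + d = 2 * n) (x : W.obj X a) (z : W.obj X c) :
    W.cupPairing X n b c h₁ (W.clambdaOp hL hX hη a b x) z =
      W.cupPairing X n a d h₂ x (W.clambdaOp hL hX hη c d z) := by
  induction x using W.lefschetz_induction hL hX hη with
  | zero => simp
  | add y y' hy hy' => simp only [map_add, LinearMap.add_apply, hy, hy']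
  | prim i j h x hx hij =>
    induction z using W.lefschetz_induction hL hX hη with
    | zero => simp
    | add z z' hz hz' => simp only [map_add, hz, hz']
    | prim i' j' h' z hz hij' =>
      rcases j with _ | s
      · -- `x` primitive: the left-hand side vanishes
        obtain rfl : a = i := by omega
        rw [W.lefschetzPow_zero_apply hX η h x, W.clambdaOp_apply_of_isPrimitive hL hX hη hx,
          map_zero, LinearMap.zero_apply]
        rcases j' with _ | s'
        · obtain rfl : i' = c := by omega
          rw [W.lefschetzPow_zero_apply hX η h' z, W.clambdaOp_apply_of_isPrimitive hL hX hη hz,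
            map_zero]
        · have hd' : i' + 2 * s' = d := by omega
          rw [W.clambdaOp_apply_lefschetzPow_succ hL hX hη h' hd' hz, map_smul]
          rcases lt_trichotomy a i' with hlt | rfl | hgt
          · rw [W.cupPairing_lefschetzPow_eq_zero_of_lt hX η hd' h₂ hlt x hz, smul_zero]
          · have hs' : ((n : ℤ) - a - s') = 0 := by omega
            rw [hs', mul_zero, Int.cast_zero, zero_smul]
          · rw [W.cupPairing_lefschetzPow_eq_zero_of_gt hX η hd' h₂ hgt hx z, smul_zero]
      · -- `x = Lˢ⁺¹ x₀`
        have hb' : i + 2 * s = b := by omega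
        rw [W.clambdaOp_apply_lefschetzPow_succ hL hX hη h hb' hx, map_smul,
          LinearMap.smul_apply]
        rcases j' with _ | s'
        · -- `z` primitive: the right-hand side vanishes, and `i < i'`
          obtain rfl : i' = c := by omega
          rw [W.lefschetzPow_zero_apply hX η h' z, W.clambdaOp_apply_of_isPrimitive hL hX hη hz,
            map_zero, ← W.lefschetzPow_zero_apply hX η h' z,
            W.cupPairing_lefschetzPow_lefschetzPow hX η (q := 0) (p := s) (r := s) (by omega) hb' h'
              rfl h₁ (show i + (i' + 2 * s) = 2 * n by omega),
            W.cupPairing_lefschetzPow_eq_zero_of_lt hX η rfl _ (by omega) x hz, smul_zero]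
        · have hd' : i' + 2 * s' = d := by omega
          obtain ⟨e, he⟩ : ∃ e, i' + 2 * (s + s' + 1) = e := ⟨_, rfl⟩
          have hie : i + e = 2 * n := by omega
          rw [W.clambdaOp_apply_lefschetzPow_succ hL hX hη h' hd' hz, map_smul,
            W.cupPairing_lefschetzPow_lefschetzPow hX η (r := s + s' + 1) (by omega) hb' h' he h₁ hie,
            W.cupPairing_lefschetzPow_lefschetzPow hX η (r := s + s' + 1) (by omega) h hd' he h₂ hie]
          rcases lt_trichotomy i i' with hlt | rfl | hgt
          · rw [W.cupPairing_lefschetzPow_eq_zero_of_lt hX η he hie hlt x hz, smul_zero, smul_zero]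
          · have hS : (s : ℤ) + s' + 1 + i = n := by
              have : s + s' + 1 + i = n := by omega
              exact_mod_cast this
            congr 2
            linear_combination ((s' : ℤ) - s) * hS
          · rw [W.cupPairing_lefschetzPow_eq_zero_of_gt hX η he hie hgt hx z, smul_zero, smul_zero]

end WeilCohomology

end Literature.AlgebraicGeometry.Motives

end
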